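import Summits.AtomisticToContinuum.FouriersLaw.Theorems.VanishingNoiseTransferNoisyFourierOfKuboLimit
import Summits.AtomisticToContinuum.FouriersLaw.Theorems.VanishingNoiseTransferNoisyFourierAbelCorrectorExists
import Summits.AtomisticToContinuum.FouriersLaw.Theorems.VanishingNoiseTransferNoisyFourierAbelLimit
import Summits.AtomisticToContinuum.FouriersLaw.Theorems.VanishingNoiseTransferNoisyFourierAbelMonotone
import Literature.MathematicalPhysics.KineticTheory.VelocityFlipNoise
import HarnessLib.Audit

/-!
# Split certificate for the crux `VanishingNoiseTransfer.NoisyFourier` (stmt-AtomisticToContinuum-11977)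

Strategist decomposition (crux-strategist seat `cstrat-stmt-AtomisticToContinuum-11977-s3`, 2026-08-17) of the
noisy Fourier law into THREE typed sub-cruxes, with the implication PROVED here sorry-free:

* `FlipFixedAbelThermodynamicLimit` (A4) — at every fixed Abel parameter `s ∈ (0,1]` the per-bond
  Abel–Green–Kubo pairing `∫ J_L·u_{L,s} dμ_T /(L−1)` of classical Abel correctors
  `(s − L_{T,T} − εS) u_{L,s} = J_L` converges as `L → ∞` (light-cone locality at time horizon `1/s`;
  verbatim the registered stub of the live line `abel-kapitza-even-corrector`, reduced by lead c4 to
  `AbelRowLocality`, p133683);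
* `FlipUpperAbelModulus` (U) — the upper Abel modulus at `0⁺`, uniform in `L` (the Fourier-law core; the
  other one-sided half is the landed theorem `stub_abelMonotone`, p135142; verbatim the registered stub);
* `FlipKuboConductanceFloor` (P) — uniform positivity of the finite-volume Kubo conductance
  `(L−1)·G_L = (L−1)·γ(1 − (γ/T²)⟨g_L, p_0² − T⟩_{μ_T})` of the flip chain, eventually in `L`
  (`g_L` any classical forward field). By the landed Kubo link this is `liminf_L D_L(ε,T) > 0` for the
  open-chain response coefficient — the flip analogue of `StaticAbelianSqueeze.ConductanceLowerBound`
  (stmt-AtomisticToContinuum-11749) and a NECESSARY condition for the crux; it is implied by the live line's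
  `stub_thomsonFloor` (floor at every `s ∈ (0,1]`) through the landed Abel limit `stub_abelLimit`.

`noisyFourier_of_subs : FlipFixedAbelThermodynamicLimit → FlipUpperAbelModulus → FlipKuboConductanceFloor →
NoisyFourier` — proof: the one-sided Abel–Moore–Osgood transfer of lead c5 with the floor moved from the Abel
pairing to the Abel limits `D_L = K_L(0⁺)` (`abel_mooreOsgood_floorD`), fed by the landed stubs A2
(`stub_abelCorrectorExists`, p133524), A3 (`stub_abelLimit`, p133374), M (`stub_abelMonotone`, p135142) and
closed by the landed `noisyFourier_of_kuboLimit` (c3, p127584). The three `def`s inline `flipGenerator` and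
`kin` (their bodies, `rfl`) so that the SAME one-line Prop terms elaborate in the route file
`Theses/VanishingNoiseTransfer.lean`, which imports neither `VelocityFlipNoise` nor `DeviceLiouville`.
-/

noncomputable section

open MeasureTheory Filter Topology
open scoped BigOperators

namespace Summit.AtomisticToContinuum.FouriersLaw.Theorems.NoisyFourier.Split

open Literature.MathematicalPhysics.KineticTheory.HeatConduction
open Summit.AtomisticToContinuum.FouriersLaw.Theses.VanishingNoiseTransfer (NoisyFourier)
open Summit.AtomisticToContinuum.FouriersLaw.Theorems.SuperadditiveResistance.DeviceLiouville (kin)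
open Summit.AtomisticToContinuum.FouriersLaw.Cruxes.NoisyFourier.AbelKapitzaEvenCorrector
  (stub_abelCorrectorExists stub_abelLimit stub_abelMonotone)

/-! ## The three sub-cruxes (route-file vocabulary: `flipGenerator` and `kin` inlined) -/

/-- SUB-CRUX A4 — THERMODYNAMIC LIMIT AT FIXED ABEL PARAMETER: for `s ∈ (0,1]` and every family `u L` of
classical Abel correctors (`C² ∩ L²(μ_T)`, `(L_{T,T} + εS) u = s u − J_L` pointwise),
`∫ J_L · u L dμ_{L,T} / (L−1)` converges as `L → ∞`. [cite: BernardinOlla2011, Thm 2] -/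
def FlipFixedAbelThermodynamicLimit : Prop :=
  ∀ (ω₂ lam β γ T ε : ℝ), 0 < ω₂ → 0 < lam → 0 < β → 0 < γ → 0 < T → 0 < ε → ∀ s : ℝ, 0 < s → s ≤ 1 → ∀ u : (L : ℕ) → Literature.MathematicalPhysics.KineticTheory.HeatConduction.PhaseSpace L → ℝ, (∀ L : ℕ, 2 ≤ L → ContDiff ℝ 2 (u L) ∧ MeasureTheory.MemLp (u L) 2 ((Literature.MathematicalPhysics.KineticTheory.HeatConduction.pinnedChain ω₂ lam β γ).gibbsMeasure L T) ∧ ∀ x, (Literature.MathematicalPhysics.KineticTheory.HeatConduction.pinnedChain ω₂ lam β γ).generator L T T (u L) x + ε * ∑ i : Fin L, (u L (x.1, Function.update x.2 i (-x.2 i)) - u L x) = s * u L x - ∑ i : Fin L, (Literature.MathematicalPhysics.KineticTheory.HeatConduction.pinnedChain ω₂ lam β γ).bondCurrent L i x) → ∃ K : ℝ, Filter.Tendsto (fun L : ℕ => (MeasureTheory.integral ((Literature.MathematicalPhysics.KineticTheory.HeatConduction.pinnedChain ω₂ lam β γ).gibbsMeasure L T) (fun x => (∑ i : Fin L, (Literature.MathematicalPhysics.KineticTheory.HeatConduction.pinnedChain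 ω₂ lam β γ).bondCurrent L i x) * u L x)) / ((L : ℝ) - 1)) Filter.atTop (nhds K)

/-- SUB-CRUX U — THE UPPER ABEL MODULUS AT `0⁺`, UNIFORM IN `L`: for every `η > 0` there are `s₀ ∈ (0,1]`
and `L₀` such that for `L ≥ max(L₀,2)`, `0 < s ≤ s' ≤ s₀` and classical Abel correctors `u` at `s`, `u'` at
`s'`: `∫ J_L u' dμ_T − ∫ J_L u dμ_T ≤ η (L−1)` (no slow positive storage share of the Green–Kubo functional,
uniformly in `L`: the Fourier-law core). [cite: BernardinOlla2011, §5 and p. 3] -/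
def FlipUpperAbelModulus : Prop :=
  ∀ (ω₂ lam β γ T ε : ℝ), 0 < ω₂ → 0 < lam → 0 < β → 0 < γ → 0 < T → 0 < ε → ∀ η : ℝ, 0 < η → ∃ s₀ : ℝ, 0 < s₀ ∧ s₀ ≤ 1 ∧ ∃ L₀ : ℕ, ∀ (L : ℕ), L₀ ≤ L → 2 ≤ L → ∀ s s' : ℝ, 0 < s → s ≤ s' → s' ≤ s₀ → ∀ u u' : Literature.MathematicalPhysics.KineticTheory.HeatConduction.PhaseSpace L → ℝ, (ContDiff ℝ 2 u ∧ MeasureTheory.MemLp u 2 ((Literature.MathematicalPhysics.KineticTheory.HeatConduction.pinnedChain ω₂ lam β γ).gibbsMeasure L T) ∧ ∀ x, (Literature.MathematicalPhysics.KineticTheory.HeatConduction.pinnedChain ω₂ lam β γ).generator L T T u x + ε * ∑ i : Fin L, (u (x.1, Function.update x.2 i (-x.2 i)) - u x) = s * u x - ∑ i : Fin L, (Literature.MathematicalPhysics.KineticTheory.HeatConduction.pinnedChain ω₂ lam β γ).bondCurrent L i x) → (ContDiff ℝ 2 u' ∧ MeasureTheory.MemLp u' 2 ((Literature.MathematicalPhysics.KineticTheory.HeatConduction.pinnedChain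 ω₂ lam β γ).gibbsMeasure L T) ∧ ∀ x, (Literature.MathematicalPhysics.KineticTheory.HeatConduction.pinnedChain ω₂ lam β γ).generator L T T u' x + ε * ∑ i : Fin L, (u' (x.1, Function.update x.2 i (-x.2 i)) - u' x) = s' * u' x - ∑ i : Fin L, (Literature.MathematicalPhysics.KineticTheory.HeatConduction.pinnedChain ω₂ lam β γ).bondCurrent L i x) → MeasureTheory.integral ((Literature.MathematicalPhysics.KineticTheory.HeatConduction.pinnedChain ω₂ lam β γ).gibbsMeasure L T) (fun x => (∑ i : Fin L, (Literature.MathematicalPhysics.KineticTheory.HeatConduction.pinnedChain ω₂ lam β γ).bondCurrent L i x) * u' x) - MeasureTheory.integral ((Literature.MathematicalPhysics.KineticTheory.HeatConduction.pinnedChain ω₂ lam β γ).gibbsMeasure L T) (fun x => (∑ i : Fin L, (Literature.MathematicalPhysics.KineticTheory.HeatConduction.pinnedChain ω₂ lam β γ).bondCurrent L i x) * u x) ≤ η * ((L : ℝ) - 1)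

/-- SUB-CRUX P — UNIFORM POSITIVITY OF THE FINITE-VOLUME KUBO CONDUCTANCE: there are `c > 0` and `L₀` such
that for all `L ≥ max(L₀,2)` and every classical forward field `g` of the left bath
(`(L_{T,T} + εS) g = −(p_0² − T)`), `c ≤ (L−1)·γ(1 − (γ/T²)∫ g (p_0² − T) dμ_T)`; by the landed Kubo link the
right-hand side is the open-chain response coefficient `D_L(ε,T)` (so this is `liminf_L D_L > 0`, necessary for
the crux). Open in print even in infinite volume for flips alone. [cite: BernardinOlla2011, §6.2] -/
def FlipKuboConductanceFloor : Prop :=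
  ∀ (ω₂ lam β γ T ε : ℝ), 0 < ω₂ → 0 < lam → 0 < β → 0 < γ → 0 < T → 0 < ε → ∃ c : ℝ, 0 < c ∧ ∃ L₀ : ℕ, ∀ (L : ℕ), L₀ ≤ L → 2 ≤ L → ∀ g : Literature.MathematicalPhysics.KineticTheory.HeatConduction.PhaseSpace L → ℝ, (ContDiff ℝ 2 g ∧ MeasureTheory.MemLp g 2 ((Literature.MathematicalPhysics.KineticTheory.HeatConduction.pinnedChain ω₂ lam β γ).gibbsMeasure L T) ∧ ∀ x, (Literature.MathematicalPhysics.KineticTheory.HeatConduction.pinnedChain ω₂ lam β γ).generator L T T g x + ε * ∑ i : Fin L, (g (x.1, Function.update x.2 i (-x.2 i)) - g x) = -((∑ i : Fin L, if i.val = 0 then x.2 i ^ 2 else 0) - T)) → c ≤ ((L : ℝ) - 1) * (γ * (1 - γ / T ^ 2 * MeasureTheory.integral ((Literature.MathematicalPhysics.KineticTheory.HeatConduction.pinnedChain ω₂ lam β γ).gibbsMeasure L T) (fun x => g x * ((∑ i : Fin L, if i.val = 0 then x.2 i ^ 2 else 0) - T))))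

/-! ## The same statements in the line's vocabulary (`flipGenerator`, `kin`): definitional unfoldings -/

/-- A4 in `flipGenerator` form (the registered stub `stub_fixedAbelThermodynamicLimit`, verbatim). [folklore] -/
theorem flipFixedAbelThermodynamicLimit_iff : FlipFixedAbelThermodynamicLimit ↔
    ∀ (ω₂ lam β γ T ε : ℝ), 0 < ω₂ → 0 < lam → 0 < β → 0 < γ → 0 < T → 0 < ε →
      ∀ s : ℝ, 0 < s → s ≤ 1 → ∀ u : (L : ℕ) → PhaseSpace L → ℝ,
        (∀ L : ℕ, 2 ≤ L → ContDiff ℝ 2 (u L) ∧ MemLp (u L) 2 ((pinnedChain ω₂ lam β γ).gibbsMeasure L T) ∧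
          ∀ x, (pinnedChain ω₂ lam β γ).flipGenerator L T T ε (u L) x =
            s * u L x - ∑ i : Fin L, (pinnedChain ω₂ lam β γ).bondCurrent L i x) →
        ∃ K : ℝ, Tendsto (fun L : ℕ => (∫ x, (∑ i : Fin L, (pinnedChain ω₂ lam β γ).bondCurrent L i x) * u L x
          ∂((pinnedChain ω₂ lam β γ).gibbsMeasure L T)) / ((L : ℝ) - 1)) atTop (𝓝 K) :=
  Iff.rfl

/-- U in `flipGenerator` form (the registered stub `stub_upperAbelModulus`, verbatim). [folklore] -/
theorem flipUpperAbelModulus_iff : FlipUpperAbelModulus ↔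
    ∀ (ω₂ lam β γ T ε : ℝ), 0 < ω₂ → 0 < lam → 0 < β → 0 < γ → 0 < T → 0 < ε → ∀ η : ℝ, 0 < η →
      ∃ s₀ : ℝ, 0 < s₀ ∧ s₀ ≤ 1 ∧ ∃ L₀ : ℕ, ∀ (L : ℕ), L₀ ≤ L → 2 ≤ L → ∀ s s' : ℝ, 0 < s → s ≤ s' → s' ≤ s₀ →
        ∀ u u' : PhaseSpace L → ℝ,
          (ContDiff ℝ 2 u ∧ MemLp u 2 ((pinnedChain ω₂ lam β γ).gibbsMeasure L T) ∧
            ∀ x, (pinnedChain ω₂ lam β γ).flipGenerator L T T ε u x =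
              s * u x - ∑ i : Fin L, (pinnedChain ω₂ lam β γ).bondCurrent L i x) →
          (ContDiff ℝ 2 u' ∧ MemLp u' 2 ((pinnedChain ω₂ lam β γ).gibbsMeasure L T) ∧
            ∀ x, (pinnedChain ω₂ lam β γ).flipGenerator L T T ε u' x =
              s' * u' x - ∑ i : Fin L, (pinnedChain ω₂ lam β γ).bondCurrent L i x) →
          (∫ x, (∑ i : Fin L, (pinnedChain ω₂ lam β γ).bondCurrent L i x) * u' x ∂((pinnedChain ω₂ lam β γ).gibbsMeasure L T)) -
            ∫ x, (∑ i : Fin L, (pinnedChain ω₂ lam β γ).bondCurrent L i x) * u x ∂((pinnedChain ω₂ lam β γ).gibbsMeasure L T)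
            ≤ η * ((L : ℝ) - 1) :=
  Iff.rfl

/-- P in `flipGenerator`/`kin` form. [folklore] -/
theorem flipKuboConductanceFloor_iff : FlipKuboConductanceFloor ↔
    ∀ (ω₂ lam β γ T ε : ℝ), 0 < ω₂ → 0 < lam → 0 < β → 0 < γ → 0 < T → 0 < ε →
      ∃ c : ℝ, 0 < c ∧ ∃ L₀ : ℕ, ∀ (L : ℕ), L₀ ≤ L → 2 ≤ L → ∀ g : PhaseSpace L → ℝ,
        (ContDiff ℝ 2 g ∧ MemLp g 2 ((pinnedChain ω₂ lam β γ).gibbsMeasure L T) ∧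
          ∀ x, (pinnedChain ω₂ lam β γ).flipGenerator L T T ε g x = -(kin L 0 x - T)) →
        c ≤ ((L : ℝ) - 1) * (γ * (1 - γ / T ^ 2 *
          ∫ x, g x * (kin L 0 x - T) ∂((pinnedChain ω₂ lam β γ).gibbsMeasure L T))) :=
  Iff.rfl

/-- **One-sided Abel–Moore–Osgood transfer** (pure real analysis, lead c5): if, eventually in `N`, the functions
`K_N` satisfy the one-sided bound `K_N(s') − K_N(s) ≥ −C(s' − s)` (`0 < s ≤ s' ≤ 1`), admit for every `η > 0`
a scale `s₀` below which they increase by at most `η` (eventually in `N`), have Abel limits `K_N(0⁺) = D_N`,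
converge in `N` at each fixed `s ∈ (0,1]`, and the Abel limits `D_N` are eventually bounded below by `c > 0`, then
`D_N` converges to a positive limit. (Lead c5's `abel_mooreOsgood_oneSided` with the floor moved from `K_N(s)` to
`D_N`; pure real analysis.) [folklore] -/
theorem abel_mooreOsgood_floorD (K : ℕ → ℝ → ℝ) (D : ℕ → ℝ) (C c : ℝ) (hc : 0 < c)
    (hmono : ∀ᶠ N in atTop, ∀ s s' : ℝ, 0 < s → s ≤ s' → s' ≤ 1 → -(C * (s' - s)) ≤ K N s' - K N s)
    (hupper : ∀ η : ℝ, 0 < η → ∃ s₀ : ℝ, 0 < s₀ ∧ s₀ ≤ 1 ∧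
      ∀ᶠ N in atTop, ∀ s s' : ℝ, 0 < s → s ≤ s' → s' ≤ s₀ → K N s' - K N s ≤ η)
    (habel : ∀ᶠ N in atTop, Tendsto (K N) (𝓝[>] 0) (𝓝 (D N)))
    (htl : ∀ s : ℝ, 0 < s → s ≤ 1 → ∃ Λ : ℝ, Tendsto (fun N => K N s) atTop (𝓝 Λ))
    (hfloor : ∀ᶠ N in atTop, c ≤ D N) :
    ∃ κ : ℝ, 0 < κ ∧ Tendsto D atTop (𝓝 κ) := by
  set C' : ℝ := max C 1 with hC'
  have hC'pos : 0 < C' := lt_of_lt_of_le one_pos (le_max_right _ _)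
  have hCC' : C ≤ C' := le_max_left _ _
  haveI : (𝓝[>] (0 : ℝ)).NeBot := nhdsGT_neBot 0
  -- (a) lower semicontinuity at `0⁺`, FREE from the one-sided bound: `D N ≤ K N s + C' s`
  have hA : ∀ᶠ N in atTop, ∀ s : ℝ, 0 < s → s ≤ 1 → D N ≤ K N s + C' * s := by
    filter_upwards [hmono, habel] with N hm ha s hs hs1
    have hev : ∀ᶠ s'' in 𝓝[>] (0 : ℝ), K N s'' ≤ K N s + C' * s := by
      have hmem : Set.Ioc (0 : ℝ) s ∈ 𝓝[>] (0 : ℝ) := Ioc_mem_nhdsGT hs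
      filter_upwards [hmem] with s'' hs''
      have h := hm s'' s hs''.1 hs''.2 hs1
      have h2 : C * (s - s'') ≤ C' * s := by
        rcases le_or_gt 0 C with hC0 | hC0
        · calc C * (s - s'') ≤ C * s := mul_le_mul_of_nonneg_left (by linarith [hs''.1]) hC0
            _ ≤ C' * s := mul_le_mul_of_nonneg_right hCC' hs.le
        · have : C * (s - s'') ≤ 0 := mul_nonpos_of_nonpos_of_nonneg hC0.le (by linarith [hs''.2])
          linarith [mul_pos hC'pos hs]
      linarith
    exact le_of_tendsto ha hev
  -- (b) upper semicontinuity at `0⁺` from `hupper`: for every `η > 0` a scale `s ∈ (0,1]` with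
  --     `|D N - K N s| ≤ η` eventually in `N`
  have hB : ∀ η : ℝ, 0 < η → ∃ s : ℝ, 0 < s ∧ s ≤ 1 ∧ ∀ᶠ N in atTop, |D N - K N s| ≤ η := by
    intro η hη
    obtain ⟨s₀, hs₀, hs₀1, hup⟩ := hupper (η / 2) (by positivity)
    set s : ℝ := min s₀ (η / (2 * C')) with hsdef
    have hs : 0 < s := lt_min hs₀ (by positivity)
    have hss₀ : s ≤ s₀ := min_le_left _ _
    have hs1 : s ≤ 1 := hss₀.trans hs₀1
    have hsC : C' * s ≤ η / 2 := by
      calc C' * s ≤ C' * (η / (2 * C')) := mul_le_mul_of_nonneg_left (min_le_right _ _) hC'pos.le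
        _ = η / 2 := by field_simp
    refine ⟨s, hs, hs1, ?_⟩
    filter_upwards [hA, hup, habel] with N hAN hupN haN
    have h1 : D N - K N s ≤ η / 2 := by linarith [hAN s hs hs1]
    -- `K N s - D N ≤ η/2`: let `s'' → 0⁺` in `K N s - K N s'' ≤ η/2`
    have hev : ∀ᶠ s'' in 𝓝[>] (0 : ℝ), K N s - η / 2 ≤ K N s'' := by
      have hmem : Set.Ioc (0 : ℝ) s ∈ 𝓝[>] (0 : ℝ) := Ioc_mem_nhdsGT hs
      filter_upwards [hmem] with s'' hs''
      have h := hupN s'' s hs''.1 hs''.2 hss₀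
      linarith
    have h2 : K N s - η / 2 ≤ D N := ge_of_tendsto haN hev
    rw [abs_le]
    constructor <;> linarith
  -- (c) `D` is Cauchy, hence convergent
  have hcauchy : CauchySeq D := by
    refine Metric.cauchySeq_iff.2 fun η hη => ?_
    obtain ⟨s, hs, hs1, hBN⟩ := hB (η / 4) (by positivity)
    obtain ⟨Λ, hΛ⟩ := htl s hs hs1
    have hΛ' : ∀ᶠ N in atTop, |K N s - Λ| < η / 4 := by
      have := (Metric.tendsto_nhds.mp hΛ) (η / 4) (by positivity)
      simpa only [Real.dist_eq] using this
    obtain ⟨N₁, hN₁⟩ := (hBN.and hΛ').exists_forall_of_atTop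
    refine ⟨N₁, fun m hm n hn => ?_⟩
    rw [Real.dist_eq]
    have hm' := hN₁ m hm
    have hn' := hN₁ n hn
    have e1 : |D m - Λ| < η / 2 := by
      calc |D m - Λ| ≤ |D m - K m s| + |K m s - Λ| := abs_sub_le _ _ _
        _ < η / 4 + η / 4 := by linarith [hm'.1, hm'.2]
        _ = η / 2 := by ring
    have e2 : |D n - Λ| < η / 2 := by
      calc |D n - Λ| ≤ |D n - K n s| + |K n s - Λ| := abs_sub_le _ _ _
        _ < η / 4 + η / 4 := by linarith [hn'.1, hn'.2]
        _ = η / 2 := by ring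
    calc |D m - D n| ≤ |D m - Λ| + |Λ - D n| := abs_sub_le _ _ _
      _ = |D m - Λ| + |D n - Λ| := by rw [abs_sub_comm Λ (D n)]
      _ < η := by linarith
  obtain ⟨κ, hκ⟩ := cauchySeq_tendsto_of_complete hcauchy
  -- (d) positivity from the floor on the Abel limits `D N = K N (0⁺)`
  have hκpos : 0 < κ := lt_of_lt_of_le hc (ge_of_tendsto hκ hfloor)
  exact ⟨κ, hκpos, hκ⟩

/-- **The three sub-cruxes give the finite-volume Green–Kubo limit** of the flip chain in exactly the form consumed
by the landed closer `noisyFourier_of_kuboLimit`: for all parameters, `T, ε > 0`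
there is `κ > 0` such that `(L−1)·γ(1 − (γ/T²)∫ g_L (p_0² − T) dμ_T) → κ` for every family of classical forward
fields `g`. Proof: choose classical Abel correctors `u_{L,s}` (A2, landed) and set
`K_L(s) := ∫ J_L u_{L,s} dμ_T /(T²(L−1))`; by A3 (landed) `K_L(0⁺) = (L−1)G_L[g_L]` for EVERY forward field; by M
(landed) `K_L` is one-sidedly monotone with constant `2C₀/T²`, by U it has an `L`-uniform upper modulus at `0⁺`, by
A4 it converges at each fixed `s`, by P the Abel limits are eventually `≥ c > 0`; `abel_mooreOsgood_floorD` concludes.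
If for some `L ≥ 2` no forward field exists the `∀ g` clause is vacuous. [folklore] -/
theorem kuboLimit_of_subs (hA4 : FlipFixedAbelThermodynamicLimit) (hUp : FlipUpperAbelModulus)
    (hFl : FlipKuboConductanceFloor) :
    ∀ (ω₂ lam β γ T ε : ℝ), 0 < ω₂ → 0 < lam → 0 < β → 0 < γ → 0 < T → 0 < ε → ∃ κ : ℝ, 0 < κ ∧
      ∀ g : (L : ℕ) → PhaseSpace L → ℝ,
        (∀ L : ℕ, 2 ≤ L → ContDiff ℝ 2 (g L) ∧ MemLp (g L) 2 ((pinnedChain ω₂ lam β γ).gibbsMeasure L T) ∧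
          ∀ x, (pinnedChain ω₂ lam β γ).flipGenerator L T T ε (g L) x = -(kin L 0 x - T)) →
        Tendsto (fun L : ℕ => ((L : ℝ) - 1) * (γ * (1 - γ / T ^ 2 *
          ∫ x, g L x * (kin L 0 x - T) ∂((pinnedChain ω₂ lam β γ).gibbsMeasure L T)))) atTop (𝓝 κ) := by
  intro ω₂ lam β γ T ε hω hl hβ hγ hT hε
  classical
  set P := pinnedChain ω₂ lam β γ with hP
  -- the forward-field predicate and the sequence of Kubo conductances
  set FF : (L : ℕ) → (PhaseSpace L → ℝ) → Prop := fun L g =>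
    ContDiff ℝ 2 g ∧ MemLp g 2 (P.gibbsMeasure L T) ∧
      ∀ x, P.flipGenerator L T T ε g x = -(kin L 0 x - T) with hFF
  set GK : (L : ℕ) → (PhaseSpace L → ℝ) → ℝ := fun L g =>
    ((L : ℝ) - 1) * (γ * (1 - γ / T ^ 2 * ∫ x, g x * (kin L 0 x - T) ∂(P.gibbsMeasure L T))) with hGK
  -- if some length carries no forward field, the claim is vacuous
  by_cases hex : ∀ L : ℕ, 2 ≤ L → ∃ g : PhaseSpace L → ℝ, FF L g
  swap
  · push Not at hex
    obtain ⟨L₀, hL₀, hno⟩ := hex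
    refine ⟨1, one_pos, fun g hg => ?_⟩
    exact absurd (hg L₀ hL₀) (hno (g L₀))
  -- a reference family of forward fields
  have hg0 : ∃ g0 : (L : ℕ) → PhaseSpace L → ℝ, ∀ L : ℕ, 2 ≤ L → FF L (g0 L) := by
    refine ⟨fun L => if h : 2 ≤ L then (hex L h).choose else fun _ => 0, fun L hL => ?_⟩
    simp only [dif_pos hL]
    exact (hex L hL).choose_spec
  obtain ⟨g0, hg0⟩ := hg0
  -- classical Abel correctors (A2, landed), junk `0` off `s > 0` or `L < 2`
  have hA2 := stub_abelCorrectorExists ω₂ lam β γ T ε hω hl hβ hγ hT hε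
  set uc : (L : ℕ) → ℝ → PhaseSpace L → ℝ := fun L s =>
    if h : 2 ≤ L ∧ 0 < s then (hA2 L h.1 s h.2).choose else fun _ => 0 with hucdef
  have huc : ∀ (L : ℕ), 2 ≤ L → ∀ s : ℝ, 0 < s →
      ContDiff ℝ 2 (uc L s) ∧ MemLp (uc L s) 2 (P.gibbsMeasure L T) ∧
        ∀ x, P.flipGenerator L T T ε (uc L s) x = s * uc L s x - ∑ i : Fin L, P.bondCurrent L i x := by
    intro L hL s hs
    have e : uc L s = (hA2 L hL s hs).choose := by simp only [hucdef, dif_pos (And.intro hL hs)]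
    rw [e]
    exact (hA2 L hL s hs).choose_spec
  -- the Abel-regularised per-bond Green–Kubo functional
  set K : ℕ → ℝ → ℝ := fun L s =>
    (∫ x, (∑ i : Fin L, P.bondCurrent L i x) * uc L s x ∂(P.gibbsMeasure L T)) / (T ^ 2 * ((L : ℝ) - 1))
    with hKdef
  have hT2 : 0 < T ^ 2 := by positivity
  -- Abel limits (A3, landed): `K_L(0⁺) = (L−1)·G_L[g]` for EVERY forward field `g`
  have habel_g : ∀ (L : ℕ), 2 ≤ L → ∀ g : PhaseSpace L → ℝ, FF L g →
      Tendsto (K L) (𝓝[>] 0) (𝓝 (GK L g)) := by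
    intro L hL g hg
    have hN1 : 0 < (L : ℝ) - 1 := by
      have : (2 : ℝ) ≤ L := by exact_mod_cast hL
      linarith
    have hden : T ^ 2 * ((L : ℝ) - 1) ≠ 0 := (mul_pos hT2 hN1).ne'
    have h := stub_abelLimit ω₂ lam β γ T ε hω hl hβ hγ hT hε L hL g hg (uc L)
      (fun s hs _ => huc L hL s hs)
    have h' := h.div_const (T ^ 2 * ((L : ℝ) - 1))
    have e : ((L : ℝ) - 1) ^ 2 * (γ * (T ^ 2 - γ * ∫ x, g x * (kin L 0 x - T) ∂(P.gibbsMeasure L T))) /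
        (T ^ 2 * ((L : ℝ) - 1)) = GK L g := by
      simp only [hGK]
      field_simp
    rw [e] at h'
    exact h'
  -- hence the reference sequence
  set D : ℕ → ℝ := fun L => GK L (g0 L) with hDdef
  have habel : ∀ᶠ L in atTop, Tendsto (K L) (𝓝[>] 0) (𝓝 (D L)) := by
    filter_upwards [eventually_ge_atTop 2] with L hL
    exact habel_g L hL (g0 L) (hg0 L hL)
  -- one-sided monotonicity in `s`, uniformly in `L` (M)
  obtain ⟨C₀, hC₀, hMono⟩ := stub_abelMonotone ω₂ lam β γ T ε hω hl hβ hγ hT hε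
  have hmono : ∀ᶠ L in atTop, ∀ s s' : ℝ, 0 < s → s ≤ s' → s' ≤ 1 →
      -(2 * C₀ / T ^ 2 * (s' - s)) ≤ K L s' - K L s := by
    filter_upwards [eventually_ge_atTop 2] with L hL s s' hs hss' _
    have hL2 : (2 : ℝ) ≤ L := by exact_mod_cast hL
    have hN1 : 0 < (L : ℝ) - 1 := by linarith
    have hden : 0 < T ^ 2 * ((L : ℝ) - 1) := mul_pos hT2 hN1
    have hs' : 0 < s' := lt_of_lt_of_le hs hss'
    have hb := hMono L hL s s' hs hss' (uc L s) (uc L s') (huc L hL s hs) (huc L hL s' hs')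
    have hK : K L s' - K L s =
        ((∫ x, (∑ i : Fin L, P.bondCurrent L i x) * uc L s' x ∂(P.gibbsMeasure L T)) -
          ∫ x, (∑ i : Fin L, P.bondCurrent L i x) * uc L s x ∂(P.gibbsMeasure L T)) /
          (T ^ 2 * ((L : ℝ) - 1)) := by
      simp only [hKdef]; ring
    rw [hK, le_div_iff₀ hden]
    have hLL : (L : ℝ) ≤ 2 * ((L : ℝ) - 1) := by linarith
    have hds : 0 ≤ s' - s := by linarith
    calc -(2 * C₀ / T ^ 2 * (s' - s)) * (T ^ 2 * ((L : ℝ) - 1)) = -(C₀ * (2 * ((L : ℝ) - 1)) * (s' - s)) := by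
          field_simp
      _ ≤ -(C₀ * L * (s' - s)) := by
          have : C₀ * L * (s' - s) ≤ C₀ * (2 * ((L : ℝ) - 1)) * (s' - s) :=
            mul_le_mul_of_nonneg_right (mul_le_mul_of_nonneg_left hLL hC₀) hds
          linarith
      _ ≤ (∫ x, (∑ i : Fin L, P.bondCurrent L i x) * uc L s' x ∂(P.gibbsMeasure L T)) -
            ∫ x, (∑ i : Fin L, P.bondCurrent L i x) * uc L s x ∂(P.gibbsMeasure L T) := hb
  -- upper Abel modulus at `0⁺`, uniformly in `L` (U)
  have hupper : ∀ η : ℝ, 0 < η → ∃ s₀ : ℝ, 0 < s₀ ∧ s₀ ≤ 1 ∧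
      ∀ᶠ L in atTop, ∀ s s' : ℝ, 0 < s → s ≤ s' → s' ≤ s₀ → K L s' - K L s ≤ η := by
    intro η hη
    obtain ⟨s₀, hs₀, hs₀1, L₀, hU⟩ :=
      (flipUpperAbelModulus_iff.1 hUp) ω₂ lam β γ T ε hω hl hβ hγ hT hε (η * T ^ 2) (by positivity)
    refine ⟨s₀, hs₀, hs₀1, ?_⟩
    filter_upwards [eventually_ge_atTop 2, eventually_ge_atTop L₀] with L hL hL₀ s s' hs hss' hs'₀
    have hL2 : (2 : ℝ) ≤ L := by exact_mod_cast hL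
    have hN1 : 0 < (L : ℝ) - 1 := by linarith
    have hden : 0 < T ^ 2 * ((L : ℝ) - 1) := mul_pos hT2 hN1
    have hs' : 0 < s' := lt_of_lt_of_le hs hss'
    have hb := hU L hL₀ hL s s' hs hss' hs'₀ (uc L s) (uc L s') (huc L hL s hs) (huc L hL s' hs')
    have hK : K L s' - K L s =
        ((∫ x, (∑ i : Fin L, P.bondCurrent L i x) * uc L s' x ∂(P.gibbsMeasure L T)) -
          ∫ x, (∑ i : Fin L, P.bondCurrent L i x) * uc L s x ∂(P.gibbsMeasure L T)) /
          (T ^ 2 * ((L : ℝ) - 1)) := by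
      simp only [hKdef]; ring
    rw [hK, div_le_iff₀ hden]
    calc (∫ x, (∑ i : Fin L, P.bondCurrent L i x) * uc L s' x ∂(P.gibbsMeasure L T)) -
            ∫ x, (∑ i : Fin L, P.bondCurrent L i x) * uc L s x ∂(P.gibbsMeasure L T)
          ≤ η * T ^ 2 * ((L : ℝ) - 1) := hb
      _ = η * (T ^ 2 * ((L : ℝ) - 1)) := by ring
  -- thermodynamic limit at fixed s (A4)
  have htl : ∀ s : ℝ, 0 < s → s ≤ 1 → ∃ Λ : ℝ, Tendsto (fun L => K L s) atTop (𝓝 Λ) := by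
    intro s hs hs1
    obtain ⟨Kinf, hKinf⟩ := (flipFixedAbelThermodynamicLimit_iff.1 hA4) ω₂ lam β γ T ε hω hl hβ hγ hT hε s hs hs1
      (fun L => uc L s) (fun L hL => huc L hL s hs)
    refine ⟨Kinf / T ^ 2, ?_⟩
    have hfun : (fun L => K L s) = fun L : ℕ =>
        ((∫ x, (∑ i : Fin L, P.bondCurrent L i x) * uc L s x ∂(P.gibbsMeasure L T)) / ((L : ℝ) - 1)) / T ^ 2 := by
      funext L
      simp only [hKdef]
      rw [mul_comm, div_mul_eq_div_div]
    rw [hfun]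
    exact hKinf.div_const _
  -- floor on the Kubo conductances `D L = GK L (g0 L)` (P)
  obtain ⟨c, hc, L₀, hfl⟩ := (flipKuboConductanceFloor_iff.1 hFl) ω₂ lam β γ T ε hω hl hβ hγ hT hε
  have hfloor : ∀ᶠ L in atTop, c ≤ D L := by
    filter_upwards [eventually_ge_atTop 2, eventually_ge_atTop L₀] with L hL hL₀
    have hb := hfl L hL₀ hL (g0 L) (hg0 L hL)
    simpa only [hDdef, hGK] using hb
  obtain ⟨κ, hκ, hconv⟩ :=
    abel_mooreOsgood_floorD K D (2 * C₀ / T ^ 2) c hc hmono hupper habel htl hfloor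
  refine ⟨κ, hκ, fun g hg => ?_⟩
  -- the Kubo sequence of an arbitrary forward-field family IS the reference sequence (uniqueness of Abel limits)
  have heq : ∀ᶠ L in atTop, GK L (g L) = D L := by
    filter_upwards [eventually_ge_atTop 2] with L hL
    haveI : (𝓝[>] (0 : ℝ)).NeBot := nhdsGT_neBot 0
    exact tendsto_nhds_unique (habel_g L hL (g L) (hg L hL)) (habel_g L hL (g0 L) (hg0 L hL))
  exact hconv.congr' (heq.mono fun L hL => hL.symm)


/-- **THE SPLIT CERTIFICATE.** `NoisyFourier` (stmt-AtomisticToContinuum-11977) follows from the three sub-cruxes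
A4 (`FlipFixedAbelThermodynamicLimit`), U (`FlipUpperAbelModulus`) and P (`FlipKuboConductanceFloor`), through
`kuboLimit_of_subs` and the landed closer `noisyFourier_of_kuboLimit`. [folklore] -/
theorem noisyFourier_of_subs :
    FlipFixedAbelThermodynamicLimit → FlipUpperAbelModulus → FlipKuboConductanceFloor → NoisyFourier :=
  fun hA4 hU hP =>
    Summit.AtomisticToContinuum.FouriersLaw.Theorems.NoisyFourier.LineAssembly.noisyFourier_of_kuboLimit
      (kuboLimit_of_subs hA4 hU hP)

/-- The split certificate in STAFFING ORDER (U, P, A4) — the argument order of the route's glue item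
`NoisyFourierOfSubs : FlipUpperAbelModulus → FlipKuboConductanceFloor → FlipFixedAbelThermodynamicLimit → NoisyFourier`
(children filed hardest-first). A prover closes that item with `fun hU hP hA4 => noisyFourier_of_subs' hU hP hA4`. [folklore] -/
theorem noisyFourier_of_subs' :
    FlipUpperAbelModulus → FlipKuboConductanceFloor → FlipFixedAbelThermodynamicLimit → NoisyFourier :=
  fun hU hP hA4 => noisyFourier_of_subs hA4 hU hP

end Summit.AtomisticToContinuum.FouriersLaw.Theorems.NoisyFourier.Split

end
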